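import Mathlib
import HarnessLib
import Summits.Parity.GeneralizedHardyLittlewood.Theorems.DilatedChowla.Negative.DilatedChowlaMirrorDefs

/-!
# `DilatedChowla` (stmt-Parity-13319): the Gram-positivity lever `CoherentBias c → ¬ DilatedChowla`

Line `Sketch` (card `siegel-mirror`), stub `stub_gram`.  The crux `LiouvilleMAD.DilatedChowla`
bounds the pencil sums `S c n n' M = Σ_{m ∈ (M,2M]} λ(mn+c) λ(mn'+c)` by `C · M^{1−κ}` uniformly in
`1 ≤ n ≠ n' ≤ 2M`.  Gram positivity in the dilation variable: for the family of dilations `qν`,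
`1 ≤ ν ≤ V` (all distinct and `≤ 2M`), put `F m = Σ_ν λ(m·qν + c)`.  Then

* `Σ_m F(m)² = Σ_{ν,ν'} S c (qν) (qν') M ≤ V·M + V²·C·M^{1−κ} ≤ 2VM` once `V·C ≤ M^κ`
  (diagonal: trivial bound `S_self_le`; off-diagonal: the crux), while
* Cauchy–Schwarz over `m ∈ (M,2M]` and the coherent bias `σ · P c (qν) M ≥ bM` (`σ = ±1`) give
  `(VbM)² ≤ (Σ_ν P c (qν) M)² = (Σ_m F m)² ≤ M · Σ_m F(m)² ≤ 2VM²`.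

Hence `b²V ≤ 2`, contradicting `b²V ≥ 4`.  Elementary; no cited facts.
-/

noncomputable section

namespace Summit.Parity.GeneralizedHardyLittlewood.Theorems.DilatedChowla.Negative

open Summit.Parity.GeneralizedHardyLittlewood.Theses.LiouvilleMAD
open Summit.Parity.GeneralizedHardyLittlewood.Theorems.DilatedTableChowla.Negative (L)
open Finset

/-- Gram expansion of a sum of squares of finite sums:
`Σ_{m ∈ A} (Σ_{ν ∈ B} f m ν)² = Σ_{ν ∈ B} Σ_{ν' ∈ B} Σ_{m ∈ A} f m ν · f m ν'`. -/
theorem sum_sq_sum_eq_gram {α β : Type*} (A : Finset α) (B : Finset β) (f : α → β → ℝ) :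
    ∑ m ∈ A, (∑ ν ∈ B, f m ν) ^ 2 = ∑ ν ∈ B, ∑ ν' ∈ B, ∑ m ∈ A, f m ν * f m ν' := by
  calc ∑ m ∈ A, (∑ ν ∈ B, f m ν) ^ 2
      = ∑ m ∈ A, ∑ ν ∈ B, ∑ ν' ∈ B, f m ν * f m ν' := by
        refine sum_congr rfl fun m _ => ?_
        rw [sq, sum_mul_sum]
    _ = ∑ ν ∈ B, ∑ m ∈ A, ∑ ν' ∈ B, f m ν * f m ν' := sum_comm
    _ = ∑ ν ∈ B, ∑ ν' ∈ B, ∑ m ∈ A, f m ν * f m ν' :=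
        sum_congr rfl fun _ _ => sum_comm

/-- The Gram matrix of the dilated family is controlled by the crux: if the pencil sums obey
`|S c n n' M| ≤ C · M^{1−κ}` for `1 ≤ n ≠ n' ≤ 2M`, then for `q ≥ 1`, `qV ≤ 2M`, `0 ≤ C` and
`V · C · M^{1−κ} ≤ M` one has `Σ_{ν,ν' ≤ V} S c (qν) (qν') M ≤ 2VM`
(diagonal `≤ M` each, off-diagonal `≤ C · M^{1−κ}` each). -/
theorem gram_sum_le {c : ℤ} {κ C : ℝ} {M q V : ℕ}
    (hC : ∀ n n' : ℕ, 1 ≤ n → 1 ≤ n' → n ≠ n' → n ≤ 2 * M → n' ≤ 2 * M →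
      |S c n n' M| ≤ C * (M : ℝ) ^ (1 - κ))
    (hq : 1 ≤ q) (hqV : q * V ≤ 2 * M) (hC0 : 0 ≤ C * (M : ℝ) ^ (1 - κ))
    (hVT : (V : ℝ) * (C * (M : ℝ) ^ (1 - κ)) ≤ M) :
    ∑ ν ∈ Icc 1 V, ∑ ν' ∈ Icc 1 V, S c (q * ν) (q * ν') M ≤ 2 * (V : ℝ) * M := by
  -- entrywise bound
  have hentry : ∀ ν ∈ Icc 1 V, ∀ ν' ∈ Icc 1 V,
      S c (q * ν) (q * ν') M ≤ (if ν = ν' then (M : ℝ) else 0) + C * (M : ℝ) ^ (1 - κ) := by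
    intro ν hν ν' hν'
    rw [mem_Icc] at hν hν'
    by_cases hνν' : ν = ν'
    · subst hνν'
      rw [if_pos rfl]
      linarith [S_self_le c (q * ν) M]
    · rw [if_neg hνν', zero_add]
      refine le_trans (le_abs_self _) (hC (q * ν) (q * ν') ?_ ?_ ?_ ?_ ?_)
      · exact (one_mul 1).symm.trans_le (Nat.mul_le_mul hq hν.1)
      · exact (one_mul 1).symm.trans_le (Nat.mul_le_mul hq hν'.1)
      · exact fun heq => hνν' (Nat.eq_of_mul_eq_mul_left (by omega) heq)
      · exact le_trans (Nat.mul_le_mul_left q hν.2) hqV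
      · exact le_trans (Nat.mul_le_mul_left q hν'.2) hqV
  calc ∑ ν ∈ Icc 1 V, ∑ ν' ∈ Icc 1 V, S c (q * ν) (q * ν') M
      ≤ ∑ ν ∈ Icc 1 V, ∑ ν' ∈ Icc 1 V,
          ((if ν = ν' then (M : ℝ) else 0) + C * (M : ℝ) ^ (1 - κ)) :=
        sum_le_sum fun ν hν => sum_le_sum fun ν' hν' => hentry ν hν ν' hν'
    _ = ∑ _ν ∈ Icc 1 V, ((M : ℝ) + V * (C * (M : ℝ) ^ (1 - κ))) := by
        refine sum_congr rfl fun ν hν => ?_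
        rw [sum_add_distrib, sum_ite_eq, if_pos hν, sum_const, Nat.card_Icc, Nat.add_sub_cancel,
          nsmul_eq_mul]
    _ ≤ ∑ _ν ∈ Icc 1 V, ((M : ℝ) + M) := sum_le_sum fun _ _ => by linarith
    _ = 2 * (V : ℝ) * M := by
        rw [sum_const, Nat.card_Icc, Nat.add_sub_cancel, nsmul_eq_mul]
        ring

/-- **Gram positivity in the dilation variable.**  For `c ≠ 0`, a coherent class bias at shift `c`
(`CoherentBias c`: for every `κ > 0` and `C`, a family of `V` progressions `c mod qν`, `1 ≤ ν ≤ V`,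
`qV ≤ 2M`, whose one-point sums `P c (qν) M` share a sign and have size `≥ bM`, with `b²V ≥ 4` and
`V·C ≤ M^κ`) is incompatible with the crux `DilatedChowla`: expanding
`Σ_{m∈(M,2M]} (Σ_ν λ(m·qν+c))²` as the Gram sum `Σ_{ν,ν'} S c (qν) (qν') M ≤ 2VM` (crux off the
diagonal) and bounding it below by `(Σ_ν P c (qν) M)²/M ≥ V²b²M` (Cauchy–Schwarz) gives `b²V ≤ 2`. -/
theorem not_dilatedChowla_of_coherentBias {c : ℤ} (hc : c ≠ 0) (h : CoherentBias c) :
    ¬ Summit.Parity.GeneralizedHardyLittlewood.Theses.LiouvilleMAD.DilatedChowla := by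
  intro hD
  obtain ⟨κ, hκ, C, hC⟩ := dilatedChowla_iff.mp hD c hc
  obtain ⟨M, q, V, b, σ, hσ, hq, hV, hqV, hb, hbV, hVC, hP⟩ := h κ hκ C
  -- the scale is positive
  have hM : 1 ≤ M := by
    have := Nat.mul_le_mul hq hV
    omega
  have hMpos : (0 : ℝ) < M := Nat.cast_pos.mpr (by omega)
  have hVpos : (0 : ℝ) < V := Nat.cast_pos.mpr (by omega)
  -- the crux constant is nonnegative (test it at `M = 1`, `n = 1`, `n' = 2`)
  have hC0 : 0 ≤ C := by
    have h12 := hC 1 1 2 le_rfl (by norm_num) (by norm_num) (by norm_num) (by norm_num)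
    rw [Nat.cast_one, Real.one_rpow, mul_one] at h12
    exact le_trans (abs_nonneg _) h12
  have hT0 : 0 ≤ C * (M : ℝ) ^ (1 - κ) := mul_nonneg hC0 (Real.rpow_nonneg hMpos.le _)
  -- `V · C · M^{1−κ} ≤ M^κ · M^{1−κ} = M`
  have hVT : (V : ℝ) * (C * (M : ℝ) ^ (1 - κ)) ≤ M := by
    have hsplit : (M : ℝ) ^ κ * (M : ℝ) ^ (1 - κ) = M := by
      rw [← Real.rpow_add hMpos]
      simp
    calc (V : ℝ) * (C * (M : ℝ) ^ (1 - κ)) = ((V : ℝ) * C) * (M : ℝ) ^ (1 - κ) := by ring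
      _ ≤ (M : ℝ) ^ κ * (M : ℝ) ^ (1 - κ) :=
          mul_le_mul_of_nonneg_right hVC (Real.rpow_nonneg hMpos.le _)
      _ = M := hsplit
  -- UPPER BOUND for the Gram sum
  have hgram_le : ∑ ν ∈ Icc 1 V, ∑ ν' ∈ Icc 1 V, S c (q * ν) (q * ν') M ≤ 2 * (V : ℝ) * M :=
    gram_sum_le (hC M) hq hqV hT0 hVT
  -- GRAM EXPANSION of `Σ_m F(m)²`, `F m = Σ_ν λ(m·qν + c)`
  have hgram : ∑ m ∈ Ioc M (2 * M), (∑ ν ∈ Icc 1 V, L ((m : ℤ) * ((q * ν : ℕ) : ℤ) + c)) ^ 2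
      = ∑ ν ∈ Icc 1 V, ∑ ν' ∈ Icc 1 V, S c (q * ν) (q * ν') M := by
    unfold S
    exact sum_sq_sum_eq_gram (Ioc M (2 * M)) (Icc 1 V)
      (fun m ν => L ((m : ℤ) * ((q * ν : ℕ) : ℤ) + c))
  -- `Σ_m F m = Σ_ν P c (qν) M`
  have hlin : ∑ m ∈ Ioc M (2 * M), ∑ ν ∈ Icc 1 V, L ((m : ℤ) * ((q * ν : ℕ) : ℤ) + c)
      = ∑ ν ∈ Icc 1 V, P c (q * ν) M := by
    unfold P
    exact sum_comm
  -- CAUCHY–SCHWARZ against the constant vector on `(M, 2M]` (`M` terms)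
  have hcard : (Ioc M (2 * M)).card = M := by
    rw [Nat.card_Ioc]
    omega
  have hCS : (∑ ν ∈ Icc 1 V, P c (q * ν) M) ^ 2
      ≤ (M : ℝ) * ∑ ν ∈ Icc 1 V, ∑ ν' ∈ Icc 1 V, S c (q * ν) (q * ν') M := by
    have := sq_sum_le_card_mul_sum_sq (s := Ioc M (2 * M))
      (f := fun m => ∑ ν ∈ Icc 1 V, L ((m : ℤ) * ((q * ν : ℕ) : ℤ) + c))
    rw [hcard, hlin, hgram] at this
    exact this
  -- LOWER BOUND from the coherent bias: `V·b·M ≤ σ · Σ_ν P c (qν) M`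
  have hbias : (V : ℝ) * (b * M) ≤ σ * ∑ ν ∈ Icc 1 V, P c (q * ν) M := by
    rw [mul_sum]
    have hconst : ∑ _ν ∈ Icc 1 V, b * (M : ℝ) = (V : ℝ) * (b * M) := by
      rw [sum_const, Nat.card_Icc, Nat.add_sub_cancel, nsmul_eq_mul]
    rw [← hconst]
    refine sum_le_sum fun ν hν => ?_
    rw [mem_Icc] at hν
    exact hP ν hν.1 hν.2
  have hσ2 : σ ^ 2 = 1 := by
    rcases hσ with h1 | h1 <;> norm_num [h1]
  have h0 : (0 : ℝ) ≤ V * (b * M) :=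
    mul_nonneg (Nat.cast_nonneg V) (mul_nonneg hb.le (Nat.cast_nonneg M))
  have hsq : ((V : ℝ) * (b * M)) ^ 2 ≤ (∑ ν ∈ Icc 1 V, P c (q * ν) M) ^ 2 := by
    calc ((V : ℝ) * (b * M)) ^ 2 ≤ (σ * ∑ ν ∈ Icc 1 V, P c (q * ν) M) ^ 2 :=
          pow_le_pow_left₀ h0 hbias 2
      _ = (∑ ν ∈ Icc 1 V, P c (q * ν) M) ^ 2 := by rw [mul_pow, hσ2, one_mul]
  have hMG : (M : ℝ) * ∑ ν ∈ Icc 1 V, ∑ ν' ∈ Icc 1 V, S c (q * ν) (q * ν') M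
      ≤ (M : ℝ) * (2 * (V : ℝ) * M) := mul_le_mul_of_nonneg_left hgram_le hMpos.le
  -- CONCLUSION: `V²b²M² ≤ 2VM²` against `4 ≤ b²V`
  have hVM : (0 : ℝ) < V * M ^ 2 := mul_pos hVpos (pow_pos hMpos 2)
  have hprod : 4 * ((V : ℝ) * M ^ 2) ≤ b ^ 2 * V * ((V : ℝ) * M ^ 2) :=
    mul_le_mul_of_nonneg_right hbV hVM.le
  nlinarith [hsq, hCS, hMG, hprod, hVM]

end Summit.Parity.GeneralizedHardyLittlewood.Theorems.DilatedChowla.Negative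

end
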